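import Summits.CriticalPhenomena.PercolationContinuityZ3.Theorems.PercNearOneGluingNoHeavyLowerTailSahiCombCylinderIdentity
import Summits.CriticalPhenomena.PercolationContinuityZ3.Theorems.PercNearOneGluingNoHeavyLowerTailSahiCombStrata
import Literature.Combinatorics.Sahi2008.PushForward

/-!
# The comb (tensor-Bernstein) hierarchy for Sahi's `E_k`, VII: the CYLINDER rung at the comb level for every `k`, and an all-order
# unconditional row — families with at most two non-cylinder members are comb-positive at every order

Support file of the one-cut programme (crux `NoHeavyLowerTail`, stmt-CriticalPhenomena-4575; cell `prim-masterthm`, seat P3; HIERARCHY.md §9).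
`…SahiCombStrata` lifted the cylinder stratum (R5) only at order 3.  With the division-free conditioning identity `sahiE_marked_eq` of
`…SahiCombCylinderIdentity` (Blinovsky's identity, recursive form) it lifts at EVERY order: for the product weight `μ_p` and the cylinder
`P = {ω | S ⊆ ω}` take `μ' = μ_{p[S↦1]}` (the frozen weight = push-forward of `μ_p` under `ω ↦ ω ∪ S`), `ν = μ_p − μ'`, `t = ∏_{e∈S} p_e`.  Then
`−E_ν[1_U] = P_p(U^{S←1} ∖ U)` is comb-positive for every up-set `U`, hence (Lieb–Sahi recursion, induction on the size) so is every
`B_ν = −E^ν` on up-set families, the marked terms are `(|T|−1)·E^{μ_p}_{|T|}` of the SET-SECTIONS `U_j^{S←1}`, and the identity is a sum of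
products of comb-positive functions with multidegrees adding to `k + 1`:

* `combPos_negSahiE_freezeDiff` — `[n = 0] − E^{μ_p − μ_{p[S↦1]}}_n(1_U)` is comb-positive at multidegree `n` for every family of `n` up-sets
  (unconditional, all `n`);
* **`combPos_sahiE_ind_cylinder_head_local`** — the all-`k` cylinder rung with LOCAL hypotheses: if every sub-family of the set-sectioned family
  `(U_j^{S←1})_j` is comb-positive at its own order, then `E_{k+1}(1_P, 1_{U_0},…,1_{U_{k−1}})` is comb-positive at multidegree `k + 1`;
  global form `combPos_sahiE_ind_cylinder_head` (GIVEN (M⁺-j) for `j ≤ k`) and positional form `combPos_sahiE_ind_of_cylinder`;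
* **`combPos_sahiE_ind_of_allButTwoCylinders`** — UNCONDITIONAL, every `n`: a family of `n` increasing events all but at most two of which
  are cylinders `{ω | S_j ⊆ ω}` has `E_n` comb-positive at multidegree `n` (the comb upgrade of Blinovsky's two-free-slot theorem
  `Literature…sahiE_bernoulliWeight_ind_nonneg_offTwo` for product measures; base (M⁺-2), induction through the local rung: set-sections
  of cylinders are cylinders).  In particular `E_n` of any family of CYLINDERS is comb-positive (the comb form of Sahi's Theorem 2 on
  indicators of principal up-sets).
HONEST FRAMING: nothing here asserts (M⁺-k) or `C_k` for `k ≥ 3`. [this work]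
-/

noncomputable section

open scoped Classical

namespace Summit.CriticalPhenomena.PercolationContinuityZ3.Theorems

open Finset Function
open Literature.Combinatorics.Sahi2008
open Literature.Probability.LatticeModels (principalUp mem_principalUp)
open Literature.Probability.Percolation.DecisionTree (ind ind_of_mem ind_of_not_mem ind_nonneg)
open SahiComb SahiCylinderIdentity SahiMomentExpansion

variable {ι : Type} [Fintype ι]

/-! ### The frozen weight as a push-forward; conditioning on a cylinder -/

/-- **Conditioning on a cylinder, any integrand**: `E_p[1_{S ⊆ ω}·f] = (∏_{e∈S} p_e)·E_{p[S↦1]}[f]`. [cite: Sahi2008, eq. (2) (p. 210)] -/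
theorem ex_ind_cylinder_mul (p : ι → unitInterval) (S : Set ι) (f : Set ι → ℝ) :
    ex (bernoulliWeight p) (ind {ω : Set ι | S ⊆ ω} * f) =
      (∏ e, if e ∈ S then (p e : ℝ) else 1) * ex (bernoulliWeight fun e => if e ∈ S then 1 else p e) f := by
  rw [ex_def, ex_def, Finset.mul_sum]
  refine Finset.sum_congr rfl fun ω _ => ?_
  have hfr := freeze_mul_bernoulliWeight_eq p S ω
  rw [Pi.mul_apply]
  conv_rhs => rw [← mul_assoc, hfr]
  by_cases hω : S ⊆ ω
  · rw [if_pos (mem_principalUp.2 hω), ind_of_mem (show ω ∈ {ω : Set ι | S ⊆ ω} from hω)]; ring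
  · rw [if_neg (fun h => hω (mem_principalUp.1 h)), ind_of_not_mem (show ω ∉ {ω : Set ι | S ⊆ ω} from hω)]; ring

/-- **The frozen weight is the push-forward of `μ_p` under `ω ↦ ω ∪ S`.** [folklore] -/
theorem pushWeight_bernoulliWeight_union (p : ι → unitInterval) (S : Set ι) :
    pushWeight (bernoulliWeight p) (fun ω : Set ι => ω ∪ S) = bernoulliWeight fun e => if e ∈ S then 1 else p e := by
  funext y
  rw [pushWeight_eq_ex, ← ex_bernoulliWeight_freeze p S (fun ω => if ω = y then (1 : ℝ) else 0), ex_def]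
  simp only [mul_ite, mul_one, mul_zero, Finset.sum_ite_eq', Finset.mem_univ, if_true]

/-- `E_n` under the frozen weight is `E_n` of the set-sections under `μ_p`. [this work] -/
theorem sahiE_freeze_eq_secUnion (p : ι → unitInterval) (S : Set ι) {n : ℕ} (V : Fin n → Set (Set ι)) :
    sahiE (bernoulliWeight fun e => if e ∈ S then 1 else p e) n (fun j => ind (V j)) =
      sahiE (bernoulliWeight p) n (fun j => ind (secUnion S (V j))) := by
  rw [← pushWeight_bernoulliWeight_union, sahiE_pushWeight]
  congr 1

/-! ### `B_ν = −E^ν` is comb-positive for `ν = μ_p − μ_{p[S↦1]}` -/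

/-- The signed weight `ν_p = μ_p − μ_{p[S↦1]}`. [this work] -/
def freezeDiff (S : Set ι) (p : ι → unitInterval) (ω : Set ι) : ℝ :=
  bernoulliWeight p ω - bernoulliWeight (fun e => if e ∈ S then 1 else p e) ω

/-- `−E_ν[1_U] = P_p(U^{S←1}) − P_p(U)` for `ν = freezeDiff S p`. [this work] -/
theorem neg_ex_freezeDiff_ind (S : Set ι) (p : ι → unitInterval) (U : Set (Set ι)) :
    - ex (freezeDiff S p) (ind U) = ex (bernoulliWeight p) (ind (secUnion S U)) - ex (bernoulliWeight p) (ind U) := by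
  rw [← ex_ind_freeze_eq_secUnion]
  simp only [ex_def, freezeDiff, sub_mul, Finset.sum_sub_distrib]
  ring

/-- **`[n = 0] − E^ν_n(1_V)` is comb-positive at multidegree `n`** for every family of `n` up-sets and `ν = μ_p − μ_{p[S↦1]}` (all `n`,
unconditional: Lieb–Sahi recursion, `−E_ν[1_U] = P(U^{S←1} ∖ U) ≥ 0` comb-positive, `CombPos.mul`). [this work] -/
theorem combPos_negSahiE_freezeDiff (S : Set ι) :
    ∀ (n : ℕ) (V : Fin n → Set (Set ι)), (∀ j, IsUpperSet (V j)) →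
      CombPos (fun _ : ι => n) (fun p => (if n = 0 then (1 : ℝ) else 0) - sahiE (freezeDiff S p) n (fun j => ind (V j)))
  | 0, V, _ => (combPos_const (fun _ : ι => 0) zero_le_one).congr fun p => by rw [if_pos rfl, sahiE_zero, sub_zero]
  | 1, V, hV => by
    refine (combPos_ex_secUnion_sub S (hV 0)).congr fun p => ?_
    rw [if_neg one_ne_zero, zero_sub, sahiE_one_apply, neg_ex_freezeDiff_ind]
  | n + 2, V, hV => by
    have hfam : (fun j => ind (V j)) = Matrix.vecCons (ind (V 0)) (fun j => ind (V j.succ)) := by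
      funext j; refine Fin.cases rfl (fun i => rfl) j
    have htail : ∀ l : Fin (n + 1), CombPos (fun _ : ι => n + 1) (fun p => (if n + 1 = 0 then (1 : ℝ) else 0) -
        sahiE (freezeDiff S p) (n + 1) (fun j => ind (update (fun j => V j.succ) l (V l.succ ∩ V 0) j))) := fun l =>
      combPos_negSahiE_freezeDiff S (n + 1) _ (isUpperSet_update_inter' (fun j => hV j.succ) (hV 0) l)
    have hrest : CombPos (fun _ : ι => n + 1) (fun p => (if n + 1 = 0 then (1 : ℝ) else 0) -
        sahiE (freezeDiff S p) (n + 1) (fun j => ind (V j.succ))) :=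
      combPos_negSahiE_freezeDiff S (n + 1) _ fun j => hV j.succ
    have hδ : CombPos (fun _ : ι => 1) (fun p => - ex (freezeDiff S p) (ind (V 0))) :=
      (combPos_ex_secUnion_sub S (hV 0)).congr fun p => neg_ex_freezeDiff_ind S p (V 0)
    have hle : (fun _ : ι => n + 1) ≤ (fun _ : ι => n + 2) := fun _ => Nat.le_succ _
    have hdeg : (fun _ : ι => n + 1) + (fun _ : ι => (1 : ℕ)) = fun _ : ι => n + 2 := by funext e; simp
    have htot := ((CombPos.sum univ fun l _ => htail l).mono hle).add (hrest.mul_of_eq hδ hdeg)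
    refine htot.congr fun p => ?_
    simp only [if_neg (Nat.succ_ne_zero _), zero_sub]
    rw [hfam, sahiE_cons]
    simp only [← ind_update_inter, Finset.sum_neg_distrib]
    ring
  where
  /-- Updating one member of an increasing family by an intersection with an increasing event keeps it increasing. [folklore] -/
  isUpperSet_update_inter' {m : ℕ} {W : Fin m → Set (Set ι)} (hW : ∀ j, IsUpperSet (W j)) {X : Set (Set ι)} (hX : IsUpperSet X)
      (l : Fin m) : ∀ j, IsUpperSet (update W l (W l ∩ X) j) := fun j => by
    by_cases hj : j = l
    · subst hj; rw [update_self]; exact (hW j).inter hX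
    · rw [update_of_ne hj]; exact hW j

/-- `polyB` of the frozen difference on an up-set family is comb-positive at the size of the index set. [this work] -/
theorem combPos_polyB_freezeDiff (S : Set ι) {k : ℕ} (U : Fin k → Set (Set ι)) (hU : ∀ j, IsUpperSet (U j)) (T : Finset (Fin k)) :
    CombPos (fun _ : ι => T.card) (fun p => polyB (freezeDiff S p) (fun j => ind (U j)) T) := by
  refine (combPos_negSahiE_freezeDiff S T.card (fun j => U (T.orderEmbOfFin rfl j)) fun j => hU _).congr fun p => ?_
  unfold polyB
  simp only [Finset.card_eq_zero]

/-! ### The marked terms: `E^{μ'}_{|T|+1}(1, g_T) = (|T| − 1)·E^{μ_p}_{|T|}` of the set-sections -/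

/-- Branching for a family of size `m ≥ 1` (index helper): `E_{m+1}(1, G) = (m − 1)·E_m(G)` under a probability weight. [cite: Sahi2008, Thm. 6 (p. 214)] -/
theorem sahiE_one_cons_of_pos {α : Type*} [Fintype α] {μ : α → ℝ} (hμ : ∑ x, μ x = 1) {m : ℕ} (hm : 0 < m) (G : Fin m → α → ℝ) :
    sahiE μ (m + 1) (Matrix.vecCons 1 G) = ((m - 1 : ℕ) : ℝ) * sahiE μ m G := by
  obtain ⟨c, rfl⟩ := Nat.exists_eq_succ_of_ne_zero hm.ne'
  rw [Nat.succ_sub_one]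
  exact sahiE_one_cons hμ c G

/-- The marked term with `h = 1` is comb-positive at multidegree `|T|`, given comb positivity of the sectioned sub-family. [this work] -/
theorem combPos_markedA_one (S : Set ι) {k : ℕ} (U : Fin k → Set (Set ι)) (T : Finset (Fin k))
    (hT : CombPos (fun _ : ι => T.card)
      (fun p => sahiE (bernoulliWeight p) T.card (fun j => ind (secUnion S (U (T.orderEmbOfFin rfl j)))))) :
    CombPos (fun _ : ι => T.card)
      (fun p => markedA (bernoulliWeight fun e => if e ∈ S then 1 else p e) 1 (fun j => ind (U j)) T) := by
  by_cases h0 : T.card = 0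
  · have hT0 : T = ∅ := Finset.card_eq_zero.1 h0
    subst hT0
    refine (combPos_const (fun _ : ι => (∅ : Finset (Fin k)).card) zero_le_one).congr fun p => ?_
    unfold markedA
    exact ex_one (sum_bernoulliWeight _)
  · have hpos : 0 < T.card := Nat.pos_of_ne_zero h0
    refine (hT.smul (Nat.cast_nonneg (T.card - 1))).congr fun p => ?_
    unfold markedA
    rw [sahiE_one_cons_of_pos (sum_bernoulliWeight _) hpos, sahiE_freeze_eq_secUnion]

/-! ### The cylinder rung, every `k` -/

/-- **The all-`k` cylinder rung at the comb level, LOCAL form.**  For a cylinder `P = {ω | S ⊆ ω}` and up-sets `U_0,…,U_{k−1}`: if every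
sub-family of the sectioned family `(U_j^{S←1})_j` has `E` comb-positive at its own order, then `p ↦ E_{k+1}(μ_p; 1_P, 1_{U_0},…,1_{U_{k−1}})`
is comb-positive at multidegree `k + 1`. [this work] -/
theorem combPos_sahiE_ind_cylinder_head_local (S : Set ι) {k : ℕ} (U : Fin k → Set (Set ι)) (hU : ∀ j, IsUpperSet (U j))
    (hsub : ∀ T : Finset (Fin k), CombPos (fun _ : ι => T.card)
      (fun p => sahiE (bernoulliWeight p) T.card (fun j => ind (secUnion S (U (T.orderEmbOfFin rfl j)))))) :
    CombPos (fun _ : ι => k + 1)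
      (fun p => sahiE (bernoulliWeight p) (k + 1) (Matrix.vecCons (ind {ω : Set ι | S ⊆ ω}) (fun j => ind (U j)))) := by
  have hterm : ∀ T ∈ (univ : Finset (Finset (Fin k))), CombPos (fun _ : ι => k)
      (fun p => markedA (bernoulliWeight fun e => if e ∈ S then 1 else p e) 1 (fun j => ind (U j)) T *
        polyB (freezeDiff S p) (fun j => ind (U j)) Tᶜ) := fun T _ =>
    (combPos_markedA_one S U T (hsub T)).mul_of_eq (combPos_polyB_freezeDiff S U hU Tᶜ)
      (funext fun _ => by simp only [Pi.add_apply]; rw [Finset.card_add_card_compl, Fintype.card_fin])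
  have hdeg : (fun _ : ι => (1 : ℕ)) + (fun _ : ι => k) = fun _ : ι => k + 1 := by funext e; simp only [Pi.add_apply]; omega
  have htot := (combPos_ex_ind {ω : Set ι | S ⊆ ω}).mul_of_eq (CombPos.sum univ hterm) hdeg
  refine htot.congr fun p => ?_
  have hid := sahiE_marked_eq (bernoulliWeight p) (bernoulliWeight fun e => if e ∈ S then 1 else p e) (freezeDiff S p)
    (ind {ω : Set ι | S ⊆ ω}) (∏ e, if e ∈ S then (p e : ℝ) else 1) (fun _ => rfl) (ex_ind_cylinder_mul p S) k 1
    (fun j => ind (U j))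
  rw [mul_one] at hid
  rw [hid, ex_ind_cylinder_eq_prod]

/-- **The all-`k` cylinder rung, global form**: GIVEN (M⁺-j) for all `j ≤ k`, `E_{k+1}(1_P, 1_U)` is comb-positive at multidegree `k + 1` for
every cylinder `P = {ω | S ⊆ ω}` and up-sets `U`. [this work] -/
theorem combPos_sahiE_ind_cylinder_head {k : ℕ} (hN : ∀ j, j ≤ k → MasterFamilyCombPos j) (S : Set ι) (U : Fin k → Set (Set ι))
    (hU : ∀ j, IsUpperSet (U j)) :
    CombPos (fun _ : ι => k + 1)
      (fun p => sahiE (bernoulliWeight p) (k + 1) (Matrix.vecCons (ind {ω : Set ι | S ⊆ ω}) (fun j => ind (U j)))) :=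
  combPos_sahiE_ind_cylinder_head_local S U hU fun T =>
    hN T.card (by simpa using Finset.card_le_univ T) ι _ fun j => isUpperSet_secUnion S (hU _)

/-- **(M⁺-≤k) ⇒ (M⁺-(k+1)) on the cylinder stratum (positional form).** [this work] -/
theorem combPos_sahiE_ind_of_cylinder {k : ℕ} (hN : ∀ j, j ≤ k + 1 → MasterFamilyCombPos j) (U : Fin (k + 2) → Set (Set ι))
    (hU : ∀ j, IsUpperSet (U j)) (m : Fin (k + 2)) (S : Set ι) (hm : U m = {ω : Set ι | S ⊆ ω}) :
    CombPos (fun _ : ι => k + 2) (fun p => sahiE (bernoulliWeight p) (k + 2) (fun j => ind (U j))) := by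
  obtain ⟨τ, hτ⟩ := exists_perm_forall_sahiE_ind_eq_cons U m
  have h := combPos_sahiE_ind_cylinder_head hN S (fun j => U (m.succAbove (τ j))) fun j => hU _
  exact h.congr fun p => by rw [hτ (bernoulliWeight p), hm]

/-! ### All but two members cylinders: comb-positive at every order, unconditionally -/

omit [Fintype ι] in
/-- Set-sections of cylinders are cylinders: `{ω | S' ⊆ ω}^{S←1} = {ω | S' ∖ S ⊆ ω}`. [folklore] -/
theorem secUnion_cylinder (S S' : Set ι) : secUnion S {ω : Set ι | S' ⊆ ω} = {ω : Set ι | S' \ S ⊆ ω} := by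
  ext ω
  simp only [mem_secUnion, Set.mem_setOf_eq]
  constructor
  · intro h x hx
    rcases h hx.1 with h1 | h1
    · exact h1
    · exact absurd h1 hx.2
  · intro h x hx
    by_cases hxS : x ∈ S
    · exact Or.inr hxS
    · exact Or.inl (h ⟨hx, hxS⟩)

/-- **Families with at most two non-cylinder members are comb-positive at EVERY order** (unconditional): if all members `U_j`, `j ∉ E`, of a
family of `n` increasing events are cylinders `{ω | S_j ⊆ ω}` for some `E` with `|E| ≤ 2`, then `p ↦ E_n(μ_p; 1_U)` is a nonnegative
combination of the degree-`n` tensor-Bernstein basis.  (Blinovsky's two-free-slot theorem, comb form, product measures; all members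
cylinders = the comb form of Sahi's Theorem 2 on principal indicators.) [this work] -/
theorem combPos_sahiE_ind_of_allButTwoCylinders :
    ∀ (n : ℕ) (U : Fin n → Set (Set ι)), (∀ j, IsUpperSet (U j)) →
      (∃ E : Finset (Fin n), E.card ≤ 2 ∧ ∀ j, j ∉ E → ∃ S : Set ι, U j = {ω : Set ι | S ⊆ ω}) →
      CombPos (fun _ : ι => n) (fun p => sahiE (bernoulliWeight p) n (fun j => ind (U j))) := by
  intro n
  induction n using Nat.strong_induction_on with
  | _ n ih =>
    intro U hU hE
    obtain ⟨E, hEcard, hcyl⟩ := hE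
    by_cases hn : n ≤ 2
    · exact masterFamilyCombPos_of_le_two hn ι U hU
    · -- some member outside `E` exists: it is a cylinder; move it to the head
      have hex : ∃ m : Fin n, m ∉ E := by
        by_contra hall
        have hall' : ∀ j : Fin n, j ∈ E := fun j => by
          by_contra hj
          exact hall ⟨j, hj⟩
        have : (univ : Finset (Fin n)).card ≤ E.card := Finset.card_le_card fun j _ => hall' j
        rw [Finset.card_univ, Fintype.card_fin] at this
        omega
      obtain ⟨m, hmE⟩ := hex
      obtain ⟨S, hS⟩ := hcyl m hmE
      obtain ⟨k, rfl⟩ : ∃ k, n = k + 2 := ⟨n - 2, by omega⟩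
      obtain ⟨τ, hτ⟩ := exists_perm_forall_sahiE_ind_eq_cons U m
      set V : Fin (k + 1) → Set (Set ι) := fun j => U (m.succAbove (τ j)) with hV
      have hVup : ∀ j, IsUpperSet (V j) := fun j => hU _
      have h := combPos_sahiE_ind_cylinder_head_local S V hVup fun T => ?_
      · exact h.congr fun p => by rw [hτ (bernoulliWeight p), hS]
      · -- the sectioned sub-family has again at most two non-cylinder members
        refine ih T.card (lt_of_le_of_lt (by simpa using Finset.card_le_univ T) (by omega)) _
          (fun j => isUpperSet_secUnion S (hVup _)) ⟨univ.filter (fun j => m.succAbove (τ (T.orderEmbOfFin rfl j)) ∈ E), ?_, ?_⟩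
        · -- the exceptional indices inject into `E`
          calc (univ.filter (fun j : Fin T.card => m.succAbove (τ (T.orderEmbOfFin rfl j)) ∈ E)).card
              ≤ E.card := by
                refine Finset.card_le_card_of_injOn (fun j => m.succAbove (τ (T.orderEmbOfFin rfl j))) (fun j hj => ?_) ?_
                · exact (Finset.mem_filter.1 (Finset.mem_coe.1 hj)).2
                · intro a _ b _ hab
                  exact (T.orderEmbOfFin rfl).injective (τ.injective (Fin.succAbove_right_injective hab))
            _ ≤ 2 := hEcard
        · intro j hj
          have hj' : m.succAbove (τ (T.orderEmbOfFin rfl j)) ∉ E := fun h' => hj (Finset.mem_filter.2 ⟨mem_univ _, h'⟩)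
          obtain ⟨S', hS'⟩ := hcyl _ hj'
          exact ⟨S' \ S, by simp only [hV, hS', secUnion_cylinder]⟩

/-- **Every family of cylinders is comb-positive at every order** (the comb form of Sahi's Theorem 2 for indicators of principal up-sets
under a product measure). [this work] -/
theorem combPos_sahiE_ind_of_cylinders {n : ℕ} (S : Fin n → Set ι) :
    CombPos (fun _ : ι => n) (fun p => sahiE (bernoulliWeight p) n (fun j => ind {ω : Set ι | S j ⊆ ω})) :=
  combPos_sahiE_ind_of_allButTwoCylinders n (fun j => {ω : Set ι | S j ⊆ ω})
    (fun j _ _ hle hω => Set.Subset.trans hω hle) ⟨∅, by simp, fun j _ => ⟨S j, rfl⟩⟩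

/-- Law-level shadow: `E_n(μ_p; 1_U) ≥ 0` for families with at most two non-cylinder members (= the tree's Blinovsky offTwo theorem for
product measures, re-proved through comb positivity). [this work] -/
theorem sahiE_ind_nonneg_of_allButTwoCylinders {n : ℕ} (p : ι → unitInterval) (U : Fin n → Set (Set ι)) (hU : ∀ j, IsUpperSet (U j))
    (hE : ∃ E : Finset (Fin n), E.card ≤ 2 ∧ ∀ j, j ∉ E → ∃ S : Set ι, U j = {ω : Set ι | S ⊆ ω}) :
    0 ≤ sahiE (bernoulliWeight p) n (fun j => ind (U j)) :=
  (combPos_sahiE_ind_of_allButTwoCylinders n U hU hE).nonneg p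

end Summit.CriticalPhenomena.PercolationContinuityZ3.Theorems
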